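import Mathlib
import HarnessLib
import Summits.ValiantsHypothesis.ValiantsHypothesis.Theses.MonotoneRestoration
import Summits.ValiantsHypothesis.ValiantsHypothesis.Theorems.MonotoneRestorationOrbitRestorationQPValueOrbitDivision
import Summits.ValiantsHypothesis.ValiantsHypothesis.Theorems.MonotoneRestorationMonotoneRestorationQPSimpleGraphCut
import Summits.ValiantsHypothesis.ValiantsHypothesis.Theorems.MonotoneRestorationMonotoneRestorationQPSparseRegime
import Literature.Computability.AlgebraicComplexity.SymmetricOrbitCircuitEval
import Literature.Computability.AlgebraicComplexity.ArithCircuitProofs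

/-!
# Route MonotoneRestoration, cruxes `MonotoneRestorationQP` (stmt-15886) and `NonnegRestorationQP` (stmt-16191) —
# THE MONOTONE SIMPLE-GRAPH CUT COLLAPSES: `Wᵐ → ¬ PolylogWidthMonotoneEasy` (helper, def-free)

`SimpleGraphCut.monotoneRestorationQP_iff_cut_witness` (p825855) reads `MonotoneRestorationQP ⟺ Wᵐ ∧ ¬ PolylogWidthMonotoneEasy`
and `SimpleGraphCut.nonnegRestorationQP_iff_monotone_cut` the same for the target `NonnegRestorationQP`, with the circuit half

  `Wᵐ`: every matrix-symmetric NONNEGATIVE family of polynomial degree and polynomial MONOTONE complexity whose complexified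
        values at `0/1` adjacency matrices of SIMPLE GRAPHS are eventually `C^{(log₂ m + c)^c}`-determined has square-symmetric
        circuits over `ℂ` of quasi-polynomial SIZE.

THIS FILE: `Wᵐ` alone refutes the route's kill witness (`not_polylogWidthMonotoneEasy_of_monotoneW`), hence
`MonotoneRestorationQP ⟺ Wᵐ` and `NonnegRestorationQP ⟺ Wᵐ` (`monotoneRestorationQP_iff_monotoneW`,
`nonnegRestorationQP_iff_monotoneW`): the Boolean circuit half is the whole crux, as for L1 (`…OrbitRestorationQPBooleanWidthCollapse.lean`).

Mechanism.  The nonnegative multiplier `E_n = Π_{p,q} x_{pq}` (all `n²` variables) is matrix-symmetric, has degree `n²` and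
monotone complexity `≤ n²`, and VANISHES AT EVERY SIMPLE-GRAPH POINT of order `m ≥ 1` (the diagonal entry `(0,0)` is `0`:
no loops).  Given a kill witness `f` (nonnegative, monotone-easy, polylog-separating), `E·f` is in `Wᵐ`'s hypothesis class
and trivially determined on simple graphs, so `Wᵐ` gives it square-symmetric circuits of quasi-polynomial size, hence
orbit; `E_n` over `ℂ` is one monomial (orbit circuit, `SparseRegime.qpSparse_size_le`) with `E_n(1) = 1 ≠ 0` at the
`Sym_n`-fixed base point `a ≡ 1`, so Strassen division in orbit currency (`ValueOrbitDivision.qpOrbitRestorable_of_mul_eq_of_eval_ne_zero`,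
item 18293) gives `map f` quasi-polynomial-ORBIT square-symmetric circuits — contradicting the orbit-form support
theorem `not_qpOrbitSymmetric_of_polylogSeparating` on the separating pair.

Reading for the steward: as for 18293, a Boolean width-to-size/orbit "circuit half" is NOT `VH`-free surplus; only
determinedness hypotheses off the Boolean points (weighted `HomIndist`, line `linear_width`) cut anything off the crux.
Honest label: glue over landed theorems; no stub closed; VP ≠ VNP untouched. [folklore; cite: Strassen1973, DawarWilsenach2025 §6–7]
-/

-- `Summit.ValiantsHypothesis.ValiantsHypothesis.…` is the tree's mandated namespace (Sub = Summit).
set_option linter.dupNamespace false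

noncomputable section

open scoped Classical

namespace Summit.ValiantsHypothesis.ValiantsHypothesis.Theorems

namespace BooleanWidthCollapse

open MvPolynomial Finset
open Summit.ValiantsHypothesis.ValiantsHypothesis.Theses.MonotoneRestoration
open Literature.Computability.AlgebraicComplexity
open Literature.ModelTheory.FiniteModelTheory
open OrbitRestorationQPDepthThreeRung

variable {n : ℕ}

/-! ### The monotone multiplier `E_n = Π_{pq} x_{pq}` -/

/-- `E_n` is invariant under independent row and column permutations (any coefficients). [folklore] -/
theorem rename_prodX {R : Type*} [CommSemiring R] (n : ℕ) (σ τ : Equiv.Perm (Fin n)) :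
    rename (fun p : Fin n × Fin n => (σ p.1, τ p.2)) (∏ P : Fin n × Fin n, (X P : MvPolynomial (Fin n × Fin n) R)) =
      ∏ P : Fin n × Fin n, X P := by
  rw [map_prod]
  simp only [rename_X]
  exact Fintype.prod_equiv (Equiv.prodCongr σ τ) _ _ fun P => rfl

/-- `deg E_n ≤ n²`. [folklore] -/
theorem totalDegree_prodX_le {R : Type*} [CommSemiring R] [Nontrivial R] (n : ℕ) :
    (∏ P : Fin n × Fin n, (X P : MvPolynomial (Fin n × Fin n) R)).totalDegree ≤ n * n := by
  refine (totalDegree_finsetProd _ _).trans ?_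
  calc ∑ P : Fin n × Fin n, (X P : MvPolynomial (Fin n × Fin n) R).totalDegree
      ≤ ∑ _P : Fin n × Fin n, 1 := sum_le_sum fun P _ => (totalDegree_X (R := R) P).le
    _ = n * n := by rw [sum_const, card_univ, Fintype.card_prod, Fintype.card_fin, smul_eq_mul, mul_one]

/-- Monotone complexity `E_n ≤ n²`. [folklore] -/
theorem complexity_prodX_le {R : Type*} [CommSemiring R] (n : ℕ) :
    complexity (∏ P : Fin n × Fin n, (X P : MvPolynomial (Fin n × Fin n) R)) ≤ n * n := by
  refine (complexity_finset_prod_le _ _).trans ?_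
  have h0 : ∀ P : Fin n × Fin n, complexity (X P : MvPolynomial (Fin n × Fin n) R) = 0 :=
    fun P => complexity_X_holds P
  simp only [h0, sum_const_zero, zero_add, card_univ, Fintype.card_prod, Fintype.card_fin, le_refl]

/-- **`E_m` vanishes at every simple-graph point of order `m ≥ 1`** (the diagonal entry `(0,0)` is `0`). [folklore] -/
theorem eval_indicator_prodX {m : ℕ} (hm : 1 ≤ m) (Xg : SimpleGraph (Fin m)) :
    eval (Set.indicator {ij : Fin m × Fin m | Xg.Adj ij.1 ij.2} (1 : Fin m × Fin m → ℂ))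
      (∏ P : Fin m × Fin m, (X P : MvPolynomial (Fin m × Fin m) ℂ)) = 0 := by
  rw [map_prod]
  refine prod_eq_zero (mem_univ ((⟨0, hm⟩ : Fin m), (⟨0, hm⟩ : Fin m))) ?_
  rw [eval_X, Set.indicator_of_notMem]
  simp only [Set.mem_setOf_eq, SimpleGraph.irrefl, not_false_eq_true]

/-- Complexification of `E_n`. [folklore] -/
theorem map_prodX (n : ℕ) :
    MvPolynomial.map (Complex.ofRealHom.comp NNReal.toRealHom)
        (∏ P : Fin n × Fin n, (X P : MvPolynomial (Fin n × Fin n) NNReal)) =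
      ∏ P : Fin n × Fin n, (X P : MvPolynomial (Fin n × Fin n) ℂ) := by
  rw [map_prod]
  simp only [map_X]

/-- `E_n` over `ℂ` is one monomial. [folklore] -/
theorem prodX_eq_monomial (n : ℕ) :
    (∏ P : Fin n × Fin n, (X P : MvPolynomial (Fin n × Fin n) ℂ)) =
      monomial (∑ P : Fin n × Fin n, Finsupp.single P 1) 1 := by
  rw [monomial_sum_one]
  rfl

/-- **`E_n` over `ℂ` is orbit-restorable with a uniform constant** (orbit circuit of a single monomial). [folklore] -/
theorem qpOrbitRestorable_prodX : ∃ c : ℕ, ∀ n : ℕ,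
    QPOrbitRestorable c n (∏ P : Fin n × Fin n, (X P : MvPolynomial (Fin n × Fin n) ℂ)) := by
  obtain ⟨c', hc'⟩ := SparseRegime.qpSparse_size_le 2
  refine ⟨c', fun n => ?_⟩
  set p : MvPolynomial (Fin n × Fin n) ℂ := ∏ P : Fin n × Fin n, X P with hp
  have hinv : ∀ σ : Equiv.Perm (Fin n), rename (fun pq : Fin n × Fin n => σ • pq) p = p :=
    fun σ => rename_prodX n σ σ
  obtain ⟨G, inst, C, hCs, hCe, hCc⟩ := OrbitCircuit.exists_symmetric_circuit_of_invariant p hinv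
  refine ⟨G, inst, C, hCs, hCe, (C.orbitSize_le_size _).trans (hCc.trans (hc' n _ _ ?_ ?_))⟩
  · calc p.support.card ≤ ({∑ P : Fin n × Fin n, Finsupp.single P 1} : Finset _).card := by
          rw [hp, prodX_eq_monomial]; exact card_le_card support_monomial_subset
      _ = 1 := card_singleton _
      _ ≤ 2 ^ ((Nat.log 2 n + 2) ^ 2) := Nat.one_le_two_pow
  · have h1 : n * n ≤ 2 ^ (2 * Nat.log 2 n + 2) := ValueOrbit.sq_le_pow_log n
    have h2 : 2 * Nat.log 2 n + 2 ≤ (Nat.log 2 n + 2) ^ 2 := by nlinarith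
    exact (totalDegree_prodX_le n).trans (h1.trans (Nat.pow_le_pow_right (by norm_num) h2))

/-- Polynomial bookkeeping: `n² + (n+2)^c + 1 ≤ (n+2)^(c+2)`. [folklore] -/
theorem bound_arith (n c : ℕ) : n * n + (n + 2) ^ c + 1 ≤ (n + 2) ^ (c + 2) := by
  have ha : 1 ≤ (n + 2) ^ c := Nat.one_le_pow _ _ (by omega)
  have : (n + 2) ^ (c + 2) = (n + 2) ^ c * ((n + 2) * (n + 2)) := by ring
  rw [this]
  nlinarith

/-! ### The collapse -/

/-- **`Wᵐ → ¬ PolylogWidthMonotoneEasy`.**  The monotone Boolean circuit half refutes the route's kill witness by itself: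
multiply the witness by `E = Π x_pq` (kills the Boolean hypothesis, keeps the class), restore `E·f` in size, divide by `E`
at the invariant base point `1` in orbit currency, and contradict the orbit-form support theorem.
[cite: Strassen1973, Satz 1] [cite: DawarWilsenach2025, Thm 5.1, §6, §7.1] -/
theorem not_polylogWidthMonotoneEasy_of_monotoneW
    (hW : ∀ f : (n : ℕ) → MvPolynomial (Fin n × Fin n) NNReal,
      (∀ (n : ℕ) (σ τ : Equiv.Perm (Fin n)),
        MvPolynomial.rename (fun p : Fin n × Fin n => (σ p.1, τ p.2)) (f n) = f n) →
      (∃ c : ℕ, ∀ n : ℕ, (f n).totalDegree ≤ (n + 2) ^ c ∧ complexity (k := NNReal) (f n) ≤ (n + 2) ^ c) →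
      (∃ c N : ℕ, ∀ m : ℕ, N ≤ m → ∀ X Y : SimpleGraph (Fin m), CkEquiv ((Nat.log 2 m + c) ^ c) X Y →
        MvPolynomial.eval (Set.indicator {ij : Fin m × Fin m | X.Adj ij.1 ij.2} 1)
            (MvPolynomial.map (Complex.ofRealHom.comp NNReal.toRealHom) (f m)) =
          MvPolynomial.eval (Set.indicator {ij : Fin m × Fin m | Y.Adj ij.1 ij.2} 1)
            (MvPolynomial.map (Complex.ofRealHom.comp NNReal.toRealHom) (f m))) →
      ∃ c : ℕ, ∀ n : ℕ, ∃ (G : Type) (_ : Fintype G)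
        (C : LabelledArithCircuit ℂ (Fin n × Fin n) Unit G),
        C.IsSymmetric (Equiv.Perm (Fin n)) ∧
          C.eval (C.output ()) = MvPolynomial.map (Complex.ofRealHom.comp NNReal.toRealHom) (f n) ∧
            Fintype.card G ≤ 2 ^ ((Nat.log 2 n + c) ^ c)) :
    ¬ PolylogWidthMonotoneEasy := by
  rintro ⟨f, hsymm, ⟨c, hbd⟩, hsep⟩
  -- the family `F = E · f`
  set F : (n : ℕ) → MvPolynomial (Fin n × Fin n) NNReal :=
    fun n => (∏ P : Fin n × Fin n, X P) * f n with hF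
  have hFsymm : ∀ (n : ℕ) (σ τ : Equiv.Perm (Fin n)),
      MvPolynomial.rename (fun p : Fin n × Fin n => (σ p.1, τ p.2)) (F n) = F n := by
    intro n σ τ
    simp only [hF, map_mul, rename_prodX, hsymm n σ τ]
  have hFbd : ∃ c : ℕ, ∀ n : ℕ, (F n).totalDegree ≤ (n + 2) ^ c ∧ complexity (k := NNReal) (F n) ≤ (n + 2) ^ c := by
    refine ⟨c + 2, fun n => ⟨?_, ?_⟩⟩
    · calc (F n).totalDegree ≤ (∏ P : Fin n × Fin n, (X P : MvPolynomial _ NNReal)).totalDegree + (f n).totalDegree :=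
            totalDegree_mul _ _
        _ ≤ n * n + (n + 2) ^ c := Nat.add_le_add (totalDegree_prodX_le n) (hbd n).1
        _ ≤ (n + 2) ^ (c + 2) := by have := bound_arith n c; omega
    · calc complexity (F n) ≤ complexity (∏ P : Fin n × Fin n, (X P : MvPolynomial _ NNReal)) +
            complexity (f n) + 1 := complexity_mul_le_holds _ _
        _ ≤ n * n + (n + 2) ^ c + 1 := by
            have h1 := complexity_prodX_le (R := NNReal) n; have h2 := (hbd n).2; omega
        _ ≤ (n + 2) ^ (c + 2) := bound_arith n c
  have hFdet : ∃ c N : ℕ, ∀ m : ℕ, N ≤ m → ∀ X Y : SimpleGraph (Fin m), CkEquiv ((Nat.log 2 m + c) ^ c) X Y →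
      MvPolynomial.eval (Set.indicator {ij : Fin m × Fin m | X.Adj ij.1 ij.2} 1)
          (MvPolynomial.map (Complex.ofRealHom.comp NNReal.toRealHom) (F m)) =
        MvPolynomial.eval (Set.indicator {ij : Fin m × Fin m | Y.Adj ij.1 ij.2} 1)
          (MvPolynomial.map (Complex.ofRealHom.comp NNReal.toRealHom) (F m)) := by
    refine ⟨0, 1, fun m hm X Y _ => ?_⟩
    simp only [hF, map_mul, map_prodX, eval_indicator_prodX hm, zero_mul]
  -- `Wᵐ` restores `E · f` in size, hence in orbit
  obtain ⟨c₁, hc₁⟩ := hW F hFsymm hFbd hFdet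
  have hFres : ∀ n, QPOrbitRestorable c₁ n (MvPolynomial.map (Complex.ofRealHom.comp NNReal.toRealHom) (F n)) := by
    intro n
    obtain ⟨G, inst, C, hCs, hCe, hCc⟩ := hc₁ n
    exact ⟨G, inst, C, hCs, hCe, (C.orbitSize_le_size _).trans hCc⟩
  -- divide by `E` at the invariant base point `1`
  obtain ⟨c₂, hc₂⟩ := qpOrbitRestorable_prodX
  have hres : ∀ n, QPOrbitRestorable (max c₁ c₂ + 38) n
      (MvPolynomial.map (Complex.ofRealHom.comp NNReal.toRealHom) (f n)) := by
    intro n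
    refine ValueOrbitDivision.qpOrbitRestorable_of_mul_eq_of_eval_ne_zero
      (F := MvPolynomial.map (Complex.ofRealHom.comp NNReal.toRealHom) (F n))
      (D := ∏ P : Fin n × Fin n, (X P : MvPolynomial (Fin n × Fin n) ℂ)) ?_ (fun _ => (1 : ℂ)) (fun _ _ => rfl) ?_
      (Restorable.qpOrbitRestorable_mono (le_max_left _ _) (hFres n))
      (Restorable.qpOrbitRestorable_mono (le_max_right _ _) (hc₂ n))
    · simp only [hF, map_mul, map_prodX]
    · rw [map_prod]
      simp only [eval_X, prod_const_one, ne_eq, one_ne_zero, not_false_eq_true]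
  -- contradiction with the orbit-form support theorem
  exact not_qpOrbitSymmetric_of_polylogSeparating
    (fun n => MvPolynomial.map (Complex.ofRealHom.comp NNReal.toRealHom) (f n)) hsep
    ⟨max c₁ c₂ + 38, fun n => hres n⟩

/-- **`MonotoneRestorationQP ⟺ Wᵐ`** (crux stmt-15886): the monotone Boolean circuit half is the whole crux. [folklore] -/
theorem monotoneRestorationQP_iff_monotoneW :
    MonotoneRestorationQP ↔
      ∀ f : (n : ℕ) → MvPolynomial (Fin n × Fin n) NNReal,
        (∀ (n : ℕ) (σ τ : Equiv.Perm (Fin n)),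
          MvPolynomial.rename (fun p : Fin n × Fin n => (σ p.1, τ p.2)) (f n) = f n) →
        (∃ c : ℕ, ∀ n : ℕ, (f n).totalDegree ≤ (n + 2) ^ c ∧ complexity (k := NNReal) (f n) ≤ (n + 2) ^ c) →
        (∃ c N : ℕ, ∀ m : ℕ, N ≤ m → ∀ X Y : SimpleGraph (Fin m), CkEquiv ((Nat.log 2 m + c) ^ c) X Y →
          MvPolynomial.eval (Set.indicator {ij : Fin m × Fin m | X.Adj ij.1 ij.2} 1)
              (MvPolynomial.map (Complex.ofRealHom.comp NNReal.toRealHom) (f m)) =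
            MvPolynomial.eval (Set.indicator {ij : Fin m × Fin m | Y.Adj ij.1 ij.2} 1)
              (MvPolynomial.map (Complex.ofRealHom.comp NNReal.toRealHom) (f m))) →
        ∃ c : ℕ, ∀ n : ℕ, ∃ (G : Type) (_ : Fintype G)
          (C : LabelledArithCircuit ℂ (Fin n × Fin n) Unit G),
          C.IsSymmetric (Equiv.Perm (Fin n)) ∧
            C.eval (C.output ()) = MvPolynomial.map (Complex.ofRealHom.comp NNReal.toRealHom) (f n) ∧
              Fintype.card G ≤ 2 ^ ((Nat.log 2 n + c) ^ c) := by
  rw [SimpleGraphCut.monotoneRestorationQP_iff_cut_witness]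
  exact ⟨fun h => h.1, fun hW => ⟨hW, not_polylogWidthMonotoneEasy_of_monotoneW hW⟩⟩

/-- **`NonnegRestorationQP ⟺ Wᵐ`** (target stmt-16191). [folklore] -/
theorem nonnegRestorationQP_iff_monotoneW :
    NonnegRestorationQP ↔
      ∀ f : (n : ℕ) → MvPolynomial (Fin n × Fin n) NNReal,
        (∀ (n : ℕ) (σ τ : Equiv.Perm (Fin n)),
          MvPolynomial.rename (fun p : Fin n × Fin n => (σ p.1, τ p.2)) (f n) = f n) →
        (∃ c : ℕ, ∀ n : ℕ, (f n).totalDegree ≤ (n + 2) ^ c ∧ complexity (k := NNReal) (f n) ≤ (n + 2) ^ c) →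
        (∃ c N : ℕ, ∀ m : ℕ, N ≤ m → ∀ X Y : SimpleGraph (Fin m), CkEquiv ((Nat.log 2 m + c) ^ c) X Y →
          MvPolynomial.eval (Set.indicator {ij : Fin m × Fin m | X.Adj ij.1 ij.2} 1)
              (MvPolynomial.map (Complex.ofRealHom.comp NNReal.toRealHom) (f m)) =
            MvPolynomial.eval (Set.indicator {ij : Fin m × Fin m | Y.Adj ij.1 ij.2} 1)
              (MvPolynomial.map (Complex.ofRealHom.comp NNReal.toRealHom) (f m))) →
        ∃ c : ℕ, ∀ n : ℕ, ∃ (G : Type) (_ : Fintype G)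
          (C : LabelledArithCircuit ℂ (Fin n × Fin n) Unit G),
          C.IsSymmetric (Equiv.Perm (Fin n)) ∧
            C.eval (C.output ()) = MvPolynomial.map (Complex.ofRealHom.comp NNReal.toRealHom) (f n) ∧
              Fintype.card G ≤ 2 ^ ((Nat.log 2 n + c) ^ c) := by
  rw [SimpleGraphCut.nonnegRestorationQP_iff_monotone_cut]
  exact ⟨fun h => h.1, fun hW => ⟨hW, not_polylogWidthMonotoneEasy_of_monotoneW hW⟩⟩

end BooleanWidthCollapse

end Summit.ValiantsHypothesis.ValiantsHypothesis.Theorems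

end
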